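import Literature.MathematicalPhysics.KineticTheory.HardSphereEulerProofs
import Literature.MathematicalPhysics.KineticTheory.HardSphereDisplacementPathLength
import Literature.Analysis.FluidPDE.ReleaseLogBoundDatum
import HarnessLib

/-!
# Space–time Lipschitz modulus of block densities on good orbits (stub `blockModulus`)

Supporting file of the line `Sketch` (card `adiabat-pricing-of-the-ceiling`, reshape r3) for the
crux `AprioriBounds` (stmt-AtomisticToContinuum-14827), proving the registered stub
`stub_blockModulus` of the lead's skeleton VERBATIM: along a good orbit of the hard-sphere flow of
`N + 1` spheres on `𝕋³` with total kinetic energy `E(z) ≤ K (N + 1)`, the block density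
`ρ̄(w, x) = empiricalDensityField w (φ(· − x)) = (N+1)⁻¹ ∑ᵢ φ(xᵢ − x)` of a smooth kernel `φ`
with `‖∇φ‖ ≤ L` satisfies

  `|ρ̄(Φ_s z, x) − ρ̄(Φ_{s'} z, x')| ≤ √3 · L · (‖x − x'‖ + |s − s'| √(2K))`.

## Proof

Particle by particle, `|φ(xᵢ(s) − x) − φ(xᵢ(s') − x')| ≤ √3 L ‖(xᵢ(s) − xᵢ(s')) − (x − x')‖`
(torus mean value inequality `Torus.abs_sub_le_of_norm_gradient_le`, `card (Fin 3) = 3`)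
`≤ √3 L (‖x − x'‖ + dist_{𝕋³}(xᵢ(s), xᵢ(s')))` (the sup norm of the pi type is below the
minimal-image distance, `Torus.norm_sub_le_euclidDist_holds`).  The displacements are bounded by
the path lengths (`HardSphereFlow.euclidDist_flow_le_integral_norm_vel`), and — summing FIRST —
`∑ᵢ ∫ ‖vᵢ‖ = ∫ ∑ᵢ ‖vᵢ(u)‖ du` (`intervalIntegral.integral_finsetSum`) with, pointwise in `u`,
Cauchy–Schwarz `(∑ᵢ ‖vᵢ(u)‖)² ≤ (N+1) ∑ᵢ ‖vᵢ(u)‖² = (N+1) · 2E(Φ_u z) = (N+1) · 2E(z) ≤ ((N+1)√(2K))²`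
(`sq_sum_le_card_mul_sum_sq`, conservation of energy `HardSphereFlow.configEnergy_flow`), whence
`∑ᵢ dist(xᵢ(s), xᵢ(s')) ≤ (N+1) √(2K) |s − s'|`; dividing by `N + 1` gives the claim.

No new definitions, no named facts; two private helper lemmas; axioms `propext`,
`Classical.choice`, `Quot.sound`.
-/

noncomputable section

open MeasureTheory Filter Set Topology
open scoped ENNReal

namespace Summit.AtomisticToContinuum.HydrodynamicLimit.Theorems.AdiabatCeiling

open Literature.MathematicalPhysics.KineticTheory Literature.Analysis.FluidPDE

/-- Pointwise Cauchy–Schwarz on the speeds along a good orbit: if `E(z) ≤ K n` then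
`∑ᵢ ‖vᵢ(u)‖ ≤ n √(2K)` at every time `u` (`(∑ᵢ ‖vᵢ‖)² ≤ n ∑ᵢ ‖vᵢ‖² = 2 n E(Φ_u z) = 2 n E(z)`). -/
private theorem sum_norm_vel_flow_le {d : Type*} [Fintype d] {ε : ℝ} {n : ℕ}
    (Φ : HardSphereFlow (Torus.geometry d) ε n) {z : Config n d (UnitAddTorus d)} (hz : z ∈ Φ.good)
    {K : ℝ} (hK : 0 ≤ K) (hE : configEnergy z ≤ K * n) (u : ℝ) :
    ∑ i, ‖(Φ.flow u z i).2‖ ≤ n * Real.sqrt (2 * K) := by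
  have hsq : (∑ i, ‖(Φ.flow u z i).2‖) ^ 2 ≤ (n * Real.sqrt (2 * K)) ^ 2 := by
    calc (∑ i, ‖(Φ.flow u z i).2‖) ^ 2
        ≤ (Finset.univ : Finset (Fin n)).card * ∑ i, ‖(Φ.flow u z i).2‖ ^ 2 :=
          sq_sum_le_card_mul_sum_sq
      _ = n * (2 * configEnergy (Φ.flow u z)) := by
          rw [Finset.card_univ, Fintype.card_fin]
          simp only [configEnergy]
          ring
      _ = n * (2 * configEnergy z) := by rw [Φ.configEnergy_flow hz u]
      _ ≤ n * (2 * (K * n)) := by gcongr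
      _ = (n * Real.sqrt (2 * K)) ^ 2 := by
          rw [mul_pow, Real.sq_sqrt (by positivity)]
          ring
  exact le_of_sq_le_sq hsq (by positivity)

/-- Sum of the displacements over `[t₁, t₂]` along a good orbit whose total speed `∑ᵢ ‖vᵢ(u)‖` is
bounded by `M` at all times: `∑ᵢ dist_{T^d}(xᵢ(t₂), xᵢ(t₁)) ≤ M (t₂ − t₁)` (path-length bound,
summed, and `∑ᵢ ∫ = ∫ ∑ᵢ`). -/
private theorem sum_euclidDist_flow_le {d : Type*} [Fintype d] {ε : ℝ} {n : ℕ}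
    (Φ : HardSphereFlow (Torus.geometry d) ε n) {z : Config n d (UnitAddTorus d)} (hz : z ∈ Φ.good)
    {M : ℝ} (hM : ∀ u, ∑ i, ‖(Φ.flow u z i).2‖ ≤ M) {t₁ t₂ : ℝ} (h12 : t₁ ≤ t₂) :
    ∑ i, Torus.euclidDist (Φ.flow t₂ z i).1 (Φ.flow t₁ z i).1 ≤ M * (t₂ - t₁) := by
  have hint : ∀ i ∈ (Finset.univ : Finset (Fin n)),
      IntervalIntegrable (fun u => ‖(Φ.flow u z i).2‖) volume t₁ t₂ :=
    fun i _ => Φ.intervalIntegrable_norm_vel_flow hz i t₁ t₂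
  have hsum : IntervalIntegrable (fun u => ∑ i, ‖(Φ.flow u z i).2‖) volume t₁ t₂ := by
    have h := IntervalIntegrable.sum Finset.univ hint
    rwa [Finset.sum_fn] at h
  calc ∑ i, Torus.euclidDist (Φ.flow t₂ z i).1 (Φ.flow t₁ z i).1
      ≤ ∑ i, ∫ u in t₁..t₂, ‖(Φ.flow u z i).2‖ :=
        Finset.sum_le_sum fun i _ => Φ.euclidDist_flow_le_integral_norm_vel hz i h12
    _ = ∫ u in t₁..t₂, ∑ i, ‖(Φ.flow u z i).2‖ := (intervalIntegral.integral_finsetSum hint).symm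
    _ ≤ ∫ u in t₁..t₂, M :=
        intervalIntegral.integral_mono_on h12 hsum intervalIntegrable_const fun u _ => hM u
    _ = M * (t₂ - t₁) := by rw [intervalIntegral.integral_const, smul_eq_mul, mul_comm]

/-- STUB `blockModulus` of the line `Sketch` (crux `AprioriBounds`, stmt-AtomisticToContinuum-14827;
reshape r3, deterministic kinematics): on a good orbit of the hard-sphere flow of `N + 1` spheres on
`𝕋³` with `E(z) ≤ K(N+1)`, the block density `ρ̄(w, x) = (N+1)⁻¹ ∑ᵢ φ(xᵢ − x)` of a smooth kernel
with `‖∇φ‖ ≤ L` is `√3·L`-Lipschitz in the centre and `√3·L·√(2K)`-Lipschitz in time: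
`|ρ̄(Φ_s z, x) − ρ̄(Φ_{s'} z, x')| ≤ √3 L (‖x − x'‖ + |s − s'| √(2K))`.  Torus mean value inequality
per particle, displacement `≤` path length, and Cauchy–Schwarz of the summed speeds against the
conserved energy (`∑ᵢ ‖vᵢ(u)‖ ≤ (N+1) √(2K)`). -/
theorem stub_blockModulus :
    ∀ (σ : ℝ) (N : ℕ) (Φ : HardSphereFlow (Torus.geometry (Fin 3)) (hsDiameter σ N) (N + 1))
      (φ : T3 → ℝ) (L K : ℝ), Literature.Analysis.FunctionSpaces.Torus.IsSmooth φ →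
      (∀ y, ‖Literature.Analysis.FunctionSpaces.Torus.gradient φ y‖ ≤ L) → 0 ≤ K →
      ∀ z ∈ Φ.good, configEnergy z ≤ K * ((N : ℝ) + 1) →
        ∀ (s s' : ℝ) (x x' : T3),
          |empiricalDensityField (Φ.flow s z) (fun y => φ (y - x)) -
              empiricalDensityField (Φ.flow s' z) (fun y => φ (y - x'))| ≤
            Real.sqrt 3 * L * (‖x - x'‖ + |s - s'| * Real.sqrt (2 * K)) := by
  intro σ N Φ φ L K hφ hL hK z hz hE s s' x x'
  have hn0 : (0 : ℝ) < (N : ℝ) + 1 := by positivity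
  have hL0 : 0 ≤ L := (norm_nonneg _).trans (hL 0)
  have hc0 : 0 ≤ Real.sqrt 3 * L := mul_nonneg (Real.sqrt_nonneg _) hL0
  have hcast : ((N + 1 : ℕ) : ℝ) = (N : ℝ) + 1 := by push_cast; rfl
  -- (1) the summed displacements: `∑ᵢ dist(xᵢ(s), xᵢ(s')) ≤ (N+1) |s − s'| √(2K)`
  have hM : ∀ u, ∑ i, ‖(Φ.flow u z i).2‖ ≤ ((N + 1 : ℕ) : ℝ) * Real.sqrt (2 * K) :=
    sum_norm_vel_flow_le Φ hz hK (by rw [hcast]; exact hE)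
  have hsumD : ∑ i, Torus.euclidDist (Φ.flow s z i).1 (Φ.flow s' z i).1 ≤
      ((N : ℝ) + 1) * (|s - s'| * Real.sqrt (2 * K)) := by
    rcases le_total s' s with h | h
    · calc ∑ i, Torus.euclidDist (Φ.flow s z i).1 (Φ.flow s' z i).1
          ≤ ((N + 1 : ℕ) : ℝ) * Real.sqrt (2 * K) * (s - s') := sum_euclidDist_flow_le Φ hz hM h
        _ = ((N : ℝ) + 1) * (|s - s'| * Real.sqrt (2 * K)) := by
            rw [hcast, abs_of_nonneg (sub_nonneg.2 h)]
            ring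
    · calc ∑ i, Torus.euclidDist (Φ.flow s z i).1 (Φ.flow s' z i).1
          = ∑ i, Torus.euclidDist (Φ.flow s' z i).1 (Φ.flow s z i).1 :=
            Finset.sum_congr rfl fun i _ => Torus.euclidDist_comm _ _
        _ ≤ ((N + 1 : ℕ) : ℝ) * Real.sqrt (2 * K) * (s' - s) := sum_euclidDist_flow_le Φ hz hM h
        _ = ((N : ℝ) + 1) * (|s - s'| * Real.sqrt (2 * K)) := by
            rw [hcast, abs_sub_comm, abs_of_nonneg (sub_nonneg.2 h)]
            ring
  -- (2) the kernel increment of one particle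
  have hterm : ∀ i, |φ ((Φ.flow s z i).1 - x) - φ ((Φ.flow s' z i).1 - x')| ≤
      Real.sqrt 3 * L * (‖x - x'‖ + Torus.euclidDist (Φ.flow s z i).1 (Φ.flow s' z i).1) := by
    intro i
    have hmv := Torus.abs_sub_le_of_norm_gradient_le hφ hL ((Φ.flow s z i).1 - x)
      ((Φ.flow s' z i).1 - x')
    simp only [Fintype.card_fin, Nat.cast_ofNat] at hmv
    refine hmv.trans (mul_le_mul_of_nonneg_left ?_ hc0)
    rw [sub_sub_sub_comm]
    calc ‖(Φ.flow s z i).1 - (Φ.flow s' z i).1 - (x - x')‖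
        ≤ ‖(Φ.flow s z i).1 - (Φ.flow s' z i).1‖ + ‖x - x'‖ := norm_sub_le _ _
      _ ≤ Torus.euclidDist (Φ.flow s z i).1 (Φ.flow s' z i).1 + ‖x - x'‖ :=
          add_le_add (Torus.norm_sub_le_euclidDist_holds _ _) le_rfl
      _ = ‖x - x'‖ + Torus.euclidDist (Φ.flow s z i).1 (Φ.flow s' z i).1 := add_comm _ _
  -- (3) average over the particles
  simp only [empiricalDensityField_eq_sum]
  rw [hcast, ← mul_sub, ← Finset.sum_sub_distrib, abs_mul, abs_of_pos (inv_pos.2 hn0),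
    inv_mul_le_iff₀ hn0]
  calc |∑ i, (φ ((Φ.flow s z i).1 - x) - φ ((Φ.flow s' z i).1 - x'))|
      ≤ ∑ i, |φ ((Φ.flow s z i).1 - x) - φ ((Φ.flow s' z i).1 - x')| :=
        Finset.abs_sum_le_sum_abs _ _
    _ ≤ ∑ i, Real.sqrt 3 * L * (‖x - x'‖ + Torus.euclidDist (Φ.flow s z i).1 (Φ.flow s' z i).1) :=
        Finset.sum_le_sum fun i _ => hterm i
    _ = Real.sqrt 3 * L *
          (((N : ℝ) + 1) * ‖x - x'‖ + ∑ i, Torus.euclidDist (Φ.flow s z i).1 (Φ.flow s' z i).1) := by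
        rw [← Finset.mul_sum, Finset.sum_add_distrib, Finset.sum_const, Finset.card_univ,
          Fintype.card_fin, nsmul_eq_mul, hcast]
    _ ≤ Real.sqrt 3 * L * (((N : ℝ) + 1) * ‖x - x'‖ + ((N : ℝ) + 1) * (|s - s'| * Real.sqrt (2 * K))) :=
        mul_le_mul_of_nonneg_left (add_le_add le_rfl hsumD) hc0
    _ = ((N : ℝ) + 1) * (Real.sqrt 3 * L * (‖x - x'‖ + |s - s'| * Real.sqrt (2 * K))) := by ring

end Summit.AtomisticToContinuum.HydrodynamicLimit.Theorems.AdiabatCeiling
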